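import Mathlib.Analysis.SpecialFunctions.Pow.Real
import Literature.Computability.AlgebraicComplexity.AlmanLi2026IteratedCWDischarge
import Literature.Barriers.MatrixMultiplication.IrreversibilityBarrierThm19
import Literature.Barriers.MatrixMultiplication.UniversalMethodBarrierAsymptoticRank

/-!
# The window of door D1 in the kernel: `3 ≤ R̃(T_{cw,2}) ≤ 3.9235` over EVERY field, unconditionally

Door D1 of this seat's census is `R̃(T_{cw,2}) ≤ 3 ⇒ ω(ℂ) = 2`
(`matrixMultiplication_of_asymptoticRank_cwTensor_two_le_three`, `SoloInformedCwTwoDoor.lean`); its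
open content is the value of one number, the asymptotic rank of the little Coppersmith–Winograd
tensor `T_{cw,2} ∈ (K³)^{⊗3}`.  This file puts the best interval known for that number into the
kernel with NO hypothesis and for EVERY field `K`:

* `asymptoticRank_cwTensor_two_le_field` — `R̃(T_{cw,2}) ≤ 3.9235` over every field;
* `cwTensor_two_asymptoticRank_window` — `3 ≤ R̃(T_{cw,2}) ≤ 3.9235` over every field
  (lower end: flattening rank `3`, tree);
* `asymptoticRank_cwTensor_two_le_unconditional`, `spectralPoint_cwTensor_two_le_unconditional` —
  over `ℂ`: `R̃(T_{cw,2}) ≤ 3.9235` and every universal spectral point is `≤ 3.9235` at `T_{cw,2}`;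
  the printed record is `3.931` (Alman–Li 2026, Thm. 1.3, Table 1: `γ'_2`, the same identity at
  `n = 4`; tree `AlmanLi2026_asymptoticRank_cwTwo_lt_holds`).

How.  The tree PROVES the Alman–Li iterated degeneration over any field
(`AlmanLi2026.thm62_cw`: `(⟨(q+2)^n⟩ ⊕ ⟨1,q^n,1⟩)^{⊠2} ⊵ cw_q^{⊠2n} ⊕ 2⊙cw_q^{⊠n}⊠⟨1,t,1⟩ ⊕ ⟨1,t²+2(q+1)^{2n},1⟩`,
`t = (q+2)^n + q^n − 2(q+1)^n`) and the Strassen-calculus step in certificate form over any field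
(`AlmanLi2026.asymptoticRank_le_of_iterated_certificate`: a `c ≥ 0` with
`(r + s^θ)² ≤ c² + 2c·t^θ + t'^θ` on `θ ∈ [2/3,1]` gives `R̃ ≤ c^{1/n}`).  Here (1) the display is
assembled in the three slice directions over an arbitrary field at `q = 2`, `n = 3`
(`r = 64`, `s = 8`, `t = 18`, `t' = 1782`; the tree's discharge `AlmanLi2026_iteratedSpeedup_cw_holds`
is over `ℂ` only), and (2) the certificate `c = 3.9235³` is checked on `[2/3,1]` by elementary real
arithmetic: with `u = 8^θ ∈ [4,8]`, `18^θ = u·(9/4)^θ ≥ 1.717u`, `1782^θ = u·(891/4)^θ ≥ 36.74u`,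
and `(64+u)² ≤ c² + (3.434c + 36.74)u` on `[4,8]` (margin `0.47` at `u = 4`; the true maximum of the
printed `F(θ)` is `60.39380…` at `θ = 2/3`, cube root `3.9234139…`).  The gen-16 file
`SoloInformedCwTwoSpeedup.lean` proved the same number CONDITIONALLY on the display (hypothesis
`AlmanLi2026_iteratedSpeedup_cw`) and over `ℂ`; the tree's unconditional records before this file were
`R̃(cw_2) < 3.96` (every field, `AlmanLi2026.asymptoticRank_cwTensor_two_lt`) and `< 3.931` (`ℂ`,
`AlmanLi2026_asymptoticRank_cwTwo_lt_holds`).  No consequence for `ω`: any bound `> 3.2688` pays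
nothing through `omega_le_logb_of_asymptoticRank_cwTensor_lt`; the door needs `= 3`.

References: J. Alman, B. Li, *Asymptotic Rank Speedup Theorems, Revisited*, arXiv:2605.21738 (2026),
§7.1, Thm. 6.2, Prop. 7.1, Table 1; Bürgisser–Clausen–Shokrollahi, *Algebraic Complexity Theory*
(1997), Ex. 15.24(7).
-/

noncomputable section

namespace Summit.MatrixMultiplication.MatrixMultiplication.Theorems

open Literature.Computability.AlgebraicComplexity
open Literature.Computability.AlgebraicComplexity.AlmanLi2026
open Literature.Barriers.MatrixMultiplication (flatteningRank_cwTensor flatteningRank_le_asymptoticRank)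

/-! ## Plumbing: the cyclic rotation of modes on the pieces of the display -/

section Plumbing

variable {K : Type} [CommSemiring K] {ι κ μ ι' κ' μ' : Type}

/-- `rotate (s ⊕ t) = rotate s ⊕ rotate t`. -/
private theorem rotate_directSum_w (s : ι → κ → μ → K) (t : ι' → κ' → μ' → K) :
    rotate (directSumTensor s t) = directSumTensor (rotate s) (rotate t) := by
  funext b c a
  rcases a with a | a <;> rcases b with b | b <;> rcases c with c | c <;> rfl

/-- `rotate (s ⊠ t) = rotate s ⊠ rotate t`. -/
private theorem rotate_kronecker_w (s : ι → κ → μ → K) (t : ι' → κ' → μ' → K) :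
    rotate (kroneckerTensor s t) = kroneckerTensor (rotate s) (rotate t) := by
  funext b c a
  simp [rotate_apply, kroneckerTensor_apply]

/-- `rotate ⟨n⟩ = ⟨n⟩`. -/
private theorem rotate_unit_w (n : ℕ) : rotate (unitTensor K n) = unitTensor K n := by
  funext b c a
  simp only [rotate_apply, unitTensor_apply]
  exact if_congr ⟨fun ⟨h1, h2⟩ => ⟨h2, (h1.trans h2).symm⟩, fun ⟨h1, h2⟩ => ⟨(h1.trans h2).symm, h1⟩⟩
    rfl rfl

/-- `rotate (t^{⊠N}) = (rotate t)^{⊠N}`. -/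
private theorem rotate_kroneckerPow_w (t : ι → κ → μ → K) (N : ℕ) :
    rotate (kroneckerPow t N) = kroneckerPow (rotate t) N := by
  funext b c a
  simp [rotate_apply, kroneckerPow_apply]

omit [CommSemiring K] in
/-- `rotate³ = id`. -/
private theorem rotate_three_w (t : ι → κ → μ → K) : rotate (rotate (rotate t)) = t := rfl

end Plumbing

/-! ## (1) The Alman–Li iterated display at `q = 2`, `n = 3`, over every field, in the three directions -/

/-- **The §7.1 display of Alman–Li at `q = 2`, `n = 3`, over an arbitrary field** (from the tree's
any-field `AlmanLi2026.thm62_cw` by relabelling restrictions, in the three slice directions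
`⟨·,1,1⟩`, `⟨1,·,1⟩`, `⟨1,1,·⟩`):
`(⟨64⟩ ⊕ L_8)^{⊠2} ⊵ cw_2^{⊠6} ⊕ ⟨2⟩⊠(cw_2^{⊠3}⊠L_18) ⊕ L_1782` (`L_m` the one-line matrix
multiplication tensor of the direction; the sizes are left as the closed terms `(2+2)^3`, `2^3`,
`(2+2)^3 + 2^3 − 2·(2+1)^3`, `(…)² + 2·(2+1)^(2·3)`). -/
theorem iteratedSpeedup_cwTwo_three_field (K : Type) [Field K] :
    AlgDegeneratesTo
      (kroneckerTensor
        (directSumTensor (unitTensor K ((2 + 2) ^ 3)) (matMulTensor K (2 ^ 3) 1 1))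
        (directSumTensor (unitTensor K ((2 + 2) ^ 3)) (matMulTensor K (2 ^ 3) 1 1)))
      (directSumTensor (kroneckerPow (cwTensor K 2) (2 * 3)) (directSumTensor
        (kroneckerTensor (unitTensor K 2) (kroneckerTensor (kroneckerPow (cwTensor K 2) 3)
          (matMulTensor K ((2 + 2) ^ 3 + 2 ^ 3 - 2 * (2 + 1) ^ 3) 1 1)))
        (matMulTensor K (((2 + 2) ^ 3 + 2 ^ 3 - 2 * (2 + 1) ^ 3) ^ 2 + 2 * (2 + 1) ^ (2 * 3)) 1 1)))
    ∧ AlgDegeneratesTo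
      (kroneckerTensor
        (directSumTensor (unitTensor K ((2 + 2) ^ 3)) (matMulTensor K 1 (2 ^ 3) 1))
        (directSumTensor (unitTensor K ((2 + 2) ^ 3)) (matMulTensor K 1 (2 ^ 3) 1)))
      (directSumTensor (kroneckerPow (cwTensor K 2) (2 * 3)) (directSumTensor
        (kroneckerTensor (unitTensor K 2) (kroneckerTensor (kroneckerPow (cwTensor K 2) 3)
          (matMulTensor K 1 ((2 + 2) ^ 3 + 2 ^ 3 - 2 * (2 + 1) ^ 3) 1)))
        (matMulTensor K 1 (((2 + 2) ^ 3 + 2 ^ 3 - 2 * (2 + 1) ^ 3) ^ 2 + 2 * (2 + 1) ^ (2 * 3)) 1)))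
    ∧ AlgDegeneratesTo
      (kroneckerTensor
        (directSumTensor (unitTensor K ((2 + 2) ^ 3)) (matMulTensor K 1 1 (2 ^ 3)))
        (directSumTensor (unitTensor K ((2 + 2) ^ 3)) (matMulTensor K 1 1 (2 ^ 3))))
      (directSumTensor (kroneckerPow (cwTensor K 2) (2 * 3)) (directSumTensor
        (kroneckerTensor (unitTensor K 2) (kroneckerTensor (kroneckerPow (cwTensor K 2) 3)
          (matMulTensor K 1 1 ((2 + 2) ^ 3 + 2 ^ 3 - 2 * (2 + 1) ^ 3))))
        (matMulTensor K 1 1 (((2 + 2) ^ 3 + 2 ^ 3 - 2 * (2 + 1) ^ 3) ^ 2 + 2 * (2 + 1) ^ (2 * 3))))) := by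
  classical
  -- the core degeneration over `K`, corner-deleted square expanded
  have hK := thm62_cw K 2 3 (by norm_num)
  rw [squareMinusCorner_eq_directSum] at hK
  have hP := tensorRestrictsTo_kroneckerPow_two_mul (cwTensor K 2) 3
  -- direction `⟨·,1,1⟩` (as produced)
  have h₁ := assemble_direction hK (tensorRestrictsTo_matMul_rotate₁ (2 ^ 3)) hP
    (tensorRestrictsTo_rotate₁_matMul _) (tensorRestrictsTo_rotate₁_matMul _)
  -- direction `⟨1,1,·⟩`: rotate once
  have hK₃ := algDegeneratesTo_rotate_modes hK
  simp only [rotate_kronecker_w, rotate_directSum_w, rotate_unit_w, rotate_kroneckerPow_w,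
    rotate_cwTensor] at hK₃
  have h₃ := assemble_direction hK₃ (tensorRestrictsTo_matMul_rotate₂ (2 ^ 3)) hP
    (tensorRestrictsTo_rotate₂_matMul _) (tensorRestrictsTo_rotate₂_matMul _)
  -- direction `⟨1,·,1⟩`: rotate twice
  have hK₂ := algDegeneratesTo_rotate_modes (algDegeneratesTo_rotate_modes hK)
  simp only [rotate_kronecker_w, rotate_directSum_w, rotate_unit_w, rotate_kroneckerPow_w,
    rotate_cwTensor, rotate_three_w] at hK₂
  have h₂ := assemble_direction hK₂
    (tensorRestrictsTo_matMulTensor_oneSliceTensor (Function.Embedding.refl (Fin (2 ^ 3)))) hP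
    (tensorRestrictsTo_oneSliceTensor_matMulTensor (Equiv.refl _))
    (tensorRestrictsTo_oneSliceTensor_matMulTensor (Equiv.refl _))
  exact ⟨h₁, h₂, h₃⟩

/-! ## (2) The numerical certificate at `n = 3`: `F(θ) ≤ 3.9235³` on `[2/3, 1]` -/

/-- Lower rational-power certificate: `L³ ≤ x² ⟹ L ≤ x^{2/3}` (`x > 0`). -/
private theorem le_rpow_twoThirds_w {x L : ℝ} (hx : 0 < x) (h : L ^ 3 ≤ x ^ 2) :
    L ≤ x ^ (2 / 3 : ℝ) := by
  have e : (x ^ (2 / 3 : ℝ)) ^ (3 : ℕ) = x ^ 2 := by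
    rw [← Real.rpow_natCast, ← Real.rpow_mul hx.le]
    norm_num
  exact le_of_pow_le_pow_left₀ (by norm_num : (3 : ℕ) ≠ 0) (Real.rpow_nonneg hx.le _) (by rw [e]; exact h)

/-- **The certificate.** For `θ ∈ [2/3, 1]`:
`(64 + 8^θ)² ≤ c² + 2c·18^θ + 1782^θ` with `c = 3.9235³ = 60.3977…`
(the printed `F(θ) = √((64+8^θ)² − 1782^θ + 18^{2θ}) − 18^θ ≤ c`; `max F = F(2/3) = 60.39380…`). -/
theorem cwTwo_iterated_certificate_three (θ : ℝ) (h₁ : 2 / 3 ≤ θ) (h₂ : θ ≤ 1) :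
    ((64 : ℝ) + (8 : ℝ) ^ θ) ^ 2 ≤
      ((3.9235 : ℝ) ^ 3) ^ 2 + 2 * ((3.9235 : ℝ) ^ 3) * (18 : ℝ) ^ θ + (1782 : ℝ) ^ θ := by
  -- `u := 8^θ ∈ [4, 8]`
  have hu4 : 4 ≤ (8 : ℝ) ^ θ := by
    have h83 : (4 : ℝ) ≤ (8 : ℝ) ^ (2 / 3 : ℝ) := le_rpow_twoThirds_w (by norm_num) (by norm_num)
    exact h83.trans (Real.rpow_le_rpow_of_exponent_le (by norm_num) h₁)
  have hu8 : (8 : ℝ) ^ θ ≤ 8 := by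
    have := Real.rpow_le_rpow_of_exponent_le (by norm_num : (1 : ℝ) ≤ 8) h₂
    rwa [Real.rpow_one] at this
  have hu0 : 0 ≤ (8 : ℝ) ^ θ := by linarith
  -- `18^θ = 8^θ · (9/4)^θ ≥ 1.717 · 8^θ`
  have h18 : (18 : ℝ) ^ θ = (8 : ℝ) ^ θ * (9 / 4 : ℝ) ^ θ := by
    rw [show (18 : ℝ) = 8 * (9 / 4) by norm_num, Real.mul_rpow (by norm_num) (by norm_num)]
  have ha : (1.717 : ℝ) ≤ (9 / 4 : ℝ) ^ θ := by
    have h0 : (1.717 : ℝ) ≤ (9 / 4 : ℝ) ^ (2 / 3 : ℝ) := le_rpow_twoThirds_w (by norm_num) (by norm_num)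
    exact h0.trans (Real.rpow_le_rpow_of_exponent_le (by norm_num) h₁)
  -- `1782^θ = 8^θ · (891/4)^θ ≥ 36.74 · 8^θ`
  have h1782 : (1782 : ℝ) ^ θ = (8 : ℝ) ^ θ * (891 / 4 : ℝ) ^ θ := by
    rw [show (1782 : ℝ) = 8 * (891 / 4) by norm_num, Real.mul_rpow (by norm_num) (by norm_num)]
  have hb : (36.74 : ℝ) ≤ (891 / 4 : ℝ) ^ θ := by
    have h0 : (36.74 : ℝ) ≤ (891 / 4 : ℝ) ^ (2 / 3 : ℝ) :=
      le_rpow_twoThirds_w (by norm_num) (by norm_num)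
    exact h0.trans (Real.rpow_le_rpow_of_exponent_le (by norm_num) h₁)
  rw [h18, h1782]
  have hua : 1.717 * (8 : ℝ) ^ θ ≤ (8 : ℝ) ^ θ * (9 / 4 : ℝ) ^ θ := by
    rw [mul_comm (1.717 : ℝ)]; exact mul_le_mul_of_nonneg_left ha hu0
  have hub : 36.74 * (8 : ℝ) ^ θ ≤ (8 : ℝ) ^ θ * (891 / 4 : ℝ) ^ θ := by
    rw [mul_comm (36.74 : ℝ)]; exact mul_le_mul_of_nonneg_left hb hu0
  have h2c : 2 * ((3.9235 : ℝ) ^ 3) * (1.717 * (8 : ℝ) ^ θ) ≤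
      2 * ((3.9235 : ℝ) ^ 3) * ((8 : ℝ) ^ θ * (9 / 4 : ℝ) ^ θ) :=
    mul_le_mul_of_nonneg_left hua (by norm_num)
  -- convexity in `u = 8^θ`: `u² ≤ 12u − 32` on `[4,8]`, then a linear check (margin `0.47` at `u = 4`)
  have hsq : ((8 : ℝ) ^ θ) ^ 2 ≤ 12 * (8 : ℝ) ^ θ - 32 := by
    nlinarith [mul_nonneg (sub_nonneg.2 hu4) (sub_nonneg.2 hu8)]
  nlinarith [hsq, h2c, hub, hu4]

/-! ## (3) The bounds -/

/-- **`R̃(T_{cw,2}) ≤ 3.9235` over EVERY field, unconditionally** (Alman–Li's iterated identity at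
`n = 3`, proved in the tree over any field, + Strassen calculus in certificate form + the certificate
above).  The printed record is `3.931` (arXiv:2605.21738, Thm. 1.3: the same identity at `n = 4`). -/
theorem asymptoticRank_cwTensor_two_le_field (K : Type) [Field K] :
    asymptoticRank (cwTensor K 2) ≤ 3.9235 := by
  obtain ⟨h₁, h₂, h₃⟩ := iteratedSpeedup_cwTwo_three_field K
  have hc0 : (0 : ℝ) ≤ (3.9235 : ℝ) ^ 3 := by norm_num
  have hmain := asymptoticRank_le_of_iterated_certificate (cwTensor K 2) (n := 3) (by norm_num)
    (by norm_num) (by norm_num) (by norm_num) h₁ h₂ h₃ hc0 (fun θ hθ₁ hθ₂ => by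
      have hc := cwTwo_iterated_certificate_three θ hθ₁ hθ₂
      have e1 : (((2 + 2) ^ 3 : ℕ) : ℝ) = 64 := by norm_num
      have e2 : ((2 ^ 3 : ℕ) : ℝ) = 8 := by norm_num
      have e3 : (((2 + 2) ^ 3 + 2 ^ 3 - 2 * (2 + 1) ^ 3 : ℕ) : ℝ) = 18 := by norm_num
      have e4 : ((((2 + 2) ^ 3 + 2 ^ 3 - 2 * (2 + 1) ^ 3) ^ 2 + 2 * (2 + 1) ^ (2 * 3) : ℕ) : ℝ)
          = 1782 := by norm_num
      rw [e1, e2, e3, e4]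
      exact hc)
  have e : ((3.9235 : ℝ) ^ 3) ^ (((3 : ℕ) : ℝ)⁻¹) = 3.9235 := by
    rw [← Real.rpow_natCast, ← Real.rpow_mul (by norm_num)]
    norm_num
  rw [e] at hmain
  exact hmain

/-- **The D1 window over every field: `3 ≤ R̃(T_{cw,2}) ≤ 3.9235`** (lower end: the flattening rank
of `T_{cw,2}` is `3` and `ζ⁽¹⁾ ≤ R̃`, tree).  The door `R̃(T_{cw,2}) ≤ 3 ⇒ ω = 2` asks for the lower
end to be attained. -/
theorem cwTensor_two_asymptoticRank_window (K : Type) [Field K] :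
    (3 : ℝ) ≤ asymptoticRank (cwTensor K 2) ∧ asymptoticRank (cwTensor K 2) ≤ 3.9235 := by
  refine ⟨?_, asymptoticRank_cwTensor_two_le_field K⟩
  have h := flatteningRank_le_asymptoticRank (cwTensor K 2)
  rw [flatteningRank_cwTensor (by norm_num : 1 ≤ 2)] at h
  exact_mod_cast h

/-- **`R̃(T_{cw,2}) ≤ 3.9235` over `ℂ`, unconditionally** (the gen-16 bound of
`SoloInformedCwTwoSpeedup.lean` with its hypothesis `AlmanLi2026_iteratedSpeedup_cw` discharged). -/
theorem asymptoticRank_cwTensor_two_le_unconditional : asymptoticRank (cwTensor ℂ 2) ≤ 3.9235 :=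
  asymptoticRank_cwTensor_two_le_field ℂ

/-- Every universal spectral point takes a value in `[3, 3.9235]` at `T_{cw,2}` (over `ℂ`;
Strassen duality, tree).  `ω(ℂ) = 2` would follow if the value were `3` at every point
(`matrixMultiplication_of_forall_spectralPoint_cwTensor_two_le_three`). -/
theorem spectralPoint_cwTensor_two_le_unconditional {F : SpectralMap ℂ}
    (hF : IsUniversalSpectralPoint ℂ F) : F (cwTensor ℂ 2) ≤ 3.9235 :=
  ((strassen_duality_asymptoticRank_holds ℂ (cwTensor ℂ 2)).1 F hF).trans
    asymptoticRank_cwTensor_two_le_unconditional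

end Summit.MatrixMultiplication.MatrixMultiplication.Theorems

end
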